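import Mathlib
import Summits.NavierStokesRegularity.NavierStokesRegularity.Theorems.ConservativeEngineFloorTools
import Summits.NavierStokesRegularity.NavierStokesRegularity.Theses.ConservativeEngine
import HarnessLib

/-!
# ConservativeEngine — the cubic floor forces gauged energy (support `FloorForcesGaugedEnergy`)

Route `ConservativeEngine` (decomp-ns node N30, rev 6 after W3 «THE ATOM SWAP»), support item
stmt-NavierStokesRegularity-28362 `FloorForcesGaugedEnergy`, PROVED here as typed:
for a field `w` with weak spatial gradient `G` on the parabolic ball `Q_{r₀}(z₀)`, the power gauge
`r^{2ρ} A(r) + r^ρ E(r) + r^{2ρ} D(r) ≤ M` (`0 < r ≤ r₀`, `0 < ρ ≤ 1/2`) and the cubic floor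
`ε₀ ≤ r^{2ρ-2} ∬_{(t₀ - r^{2+ρ}, t₀) × B_r(x₀)} |w|³` along radii `r → 0` force persisting gauged ball
energy `η₀ ≤ r^{2ρ-1} ∫_{B_r(x₀)} |w(s)|²` along `r → 0`, `s ↑ t₀`, with `η₀ = η₀(ε₀, M, C_S) > 0`.

## Proof (Caffarelli–Kohn–Nirenberg 1982, §2 (2.8)–(2.10); Robinson–Rodrigo–Sadowski 2016, Lemma 15.10)

Fix `η₀` (below) and `R > 0`, `s₁ < t₀`; suppose `r^{2ρ-1} ∫_{B_r} |w(s)|² < η₀` for all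
`r < R`, `s₁ < s < t₀`. Pick a floor radius `r < min(R, 1, r₀, t₀ - s₁)`; the thin window
`I = (t₀ - r^{2+ρ}, t₀)` lies inside `(t₀ - r², t₀) ∩ (s₁, t₀)`. For a.e. `s ∈ I` the slice `w(s)`
has weak derivative `G(s)` on `B_r` (`HasWeakSpatialGradientOn.ae_hasWeakFDerivOn_ball`), so the
scale-invariant Sobolev inequality on balls (`FunctionSpaces.exists_eLpNorm_le_ball`, `p = 2 → 6`)
and Hölder give `∫_{B_r} |w(s)|³ ≤ ā^{3/4} (2C_S)^{3/2} (r⁻² ā + e(s))^{3/4}` with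
`ā = η₀ r^{1-2ρ}`, `e(s) = ∫_{B_r} |G(s)|²`. Hölder in time on `|I| = r^{2+ρ}` and
`∫_I e ≤ r E(r) ≤ M r^{1-ρ}` give `r^{2ρ-2} ∬_{I × B_r} |w|³ ≤ (2C_S)^{3/2} η₀^{3/4} (η₀ + M)^{3/4}`
(the exponents `(2ρ-2) + ¾(1-2ρ) + ¾(1-ρ) + ¼(2+ρ)` sum to `0`), which is `< ε₀` for `η₀` small:
contradiction with the floor. The hypothesis `IsSuitableWeakSolutionInBall` is not used.

No new definitions; Navier–Stokes regularity is NOT proved by anything here (rung 0).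
-/

-- the summit and its single sub-problem share the name (CONVENTIONS §1), as in every Theorems file
set_option linter.dupNamespace false

noncomputable section

open scoped NNReal ENNReal Topology
open MeasureTheory Set Metric Filter Function TopologicalSpace Module
open Literature.Analysis Literature.Analysis.FluidPDE

namespace Summit.NavierStokesRegularity.NavierStokesRegularity.Theorems.ConservativeEngine.Floor

open FloorTools

/-! ### The support, as typed -/

/-- **`FloorForcesGaugedEnergy` (stmt-NavierStokesRegularity-28362) holds as typed**: the cubic
floor on the thin windows `(t₀ - r^{2+ρ}, t₀) × B_r` together with the `A/E` power gauge forces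
persisting gauged ball energy `η₀ ≤ r^{2ρ-1} ∫_{B_r} |w(s)|²` along `r → 0`, `s ↑ t₀`
(slice Sobolev `H¹(B_r) ⊂ L⁶(B_r)` with scale-invariant constant, Hölder in space and in time;
Caffarelli–Kohn–Nirenberg 1982, §2 (2.8)–(2.10)). See the module docstring. [cite: CaffarelliKohnNirenberg1982, §2 (2.8)–(2.10)] -/
theorem floorForcesGaugedEnergy_proof :
    Summit.NavierStokesRegularity.NavierStokesRegularity.Theses.ConservativeEngine.FloorForcesGaugedEnergy := by
  unfold Summit.NavierStokesRegularity.NavierStokesRegularity.Theses.ConservativeEngine.FloorForcesGaugedEnergy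
  intro ρ r₀ z₀ w q G hρ hρ2 hr₀ _hsw hG hM hfl
  obtain ⟨M, hM⟩ := hM
  obtain ⟨ε₀, hε₀, hfl⟩ := hfl
  obtain ⟨CS, hCS⟩ := exists_sobolev_six_ball
  -- the constants `Kc = (2 C_S)^{3/2}` and `η₀ = η₀(ε₀, M, C_S)`
  set Kc : ℝ≥0∞ := ((2 * CS : ℝ≥0) : ℝ≥0∞) ^ (3 / 2 : ℝ) with hKc
  obtain ⟨η₀, hη₀, hη₁, hsmall⟩ := exists_small_eta ((2 * CS) ^ (3 / 2 : ℝ)) M hε₀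
  have hKcoe : (((2 * CS) ^ (3 / 2 : ℝ) : ℝ≥0) : ℝ≥0∞) = Kc :=
    ENNReal.coe_rpow_of_nonneg _ (by norm_num)
  have hsmall' : Kc * (((η₀ : ℝ≥0∞) * ((M : ℝ≥0∞) + 1)) ^ (3 / 4 : ℝ)) < ENNReal.ofReal ε₀ := by
    rw [← hKcoe]; exact hsmall
  refine ⟨η₀, hη₀, fun R hR s₁ hs₁ => ?_⟩
  by_contra hcon
  push Not at hcon
  -- a floor radius below `min (R, 1, r₀, t₀ - s₁)`
  set δ : ℝ := min (min R 1) (min r₀ (z₀.1 - s₁)) with hδ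
  have hδpos : 0 < δ := lt_min (lt_min hR one_pos) (lt_min hr₀ (by linarith))
  obtain ⟨r, ⟨hr0, hrδ⟩, hfloor⟩ := hfl δ hδpos
  have hrR : r < R := hrδ.trans_le ((min_le_left _ _).trans (min_le_left _ _))
  have hr1 : r < 1 := hrδ.trans_le ((min_le_left _ _).trans (min_le_right _ _))
  have hrr₀ : r < r₀ := hrδ.trans_le ((min_le_right _ _).trans (min_le_left _ _))
  have hrs : r < z₀.1 - s₁ := hrδ.trans_le ((min_le_right _ _).trans (min_le_right _ _))
  -- real powers of `r`: the thin window is inside `Q_r` and inside `(s₁, t₀)`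
  have hw2 : r ^ (2 + ρ) ≤ r ^ 2 := by
    calc r ^ (2 + ρ) ≤ r ^ (2 : ℝ) := Real.rpow_le_rpow_of_exponent_ge hr0 hr1.le (by linarith)
      _ = r ^ 2 := Real.rpow_two r
  have hw1 : r ^ (2 + ρ) ≤ r := by
    calc r ^ (2 + ρ) ≤ r ^ (1 : ℝ) := Real.rpow_le_rpow_of_exponent_ge hr0 hr1.le (by linarith)
      _ = r := Real.rpow_one r
  -- `ℝ≥0∞` powers of `r`
  set Rr : ℝ≥0∞ := ENNReal.ofReal r with hRr
  have hR0 : Rr ≠ 0 := (ENNReal.ofReal_pos.2 hr0).ne'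
  have hRt : Rr ≠ ⊤ := ENNReal.ofReal_ne_top
  have hpow : ∀ x : ℝ, ENNReal.ofReal (r ^ x) = Rr ^ x := fun x =>
    (ENNReal.ofReal_rpow_of_pos hr0).symm
  have hRne : ∀ y : ℝ, Rr ^ y ≠ ⊤ := fun y => by rw [← hpow]; exact ENNReal.ofReal_ne_top
  have hRpos : ∀ y : ℝ, Rr ^ y ≠ 0 := fun y => (ENNReal.rpow_pos (pos_iff_ne_zero.2 hR0) hRt).ne'
  -- the sets
  set I : Set ℝ := Ioo (z₀.1 - r ^ (2 + ρ)) z₀.1 with hI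
  set J : Set ℝ := Ioo (z₀.1 - r ^ 2) z₀.1 with hJ
  set B : Set (EuclideanSpace ℝ (Fin 3)) := ball z₀.2 r with hB
  have hIJ : I ⊆ J := Ioo_subset_Ioo (by linarith) le_rfl
  have hIS : I ⊆ Ioo s₁ z₀.1 := Ioo_subset_Ioo (by linarith) le_rfl
  have hQ : parabolicCylinder r z₀ = J ×ˢ B := rfl
  -- weak gradient on `Q_r(z₀)` and its slices
  have hGr : HasWeakSpatialGradientOn (parabolicCylinderOpens r z₀) w G :=
    hG.mono (parabolicCylinderOpens_mono hr0.le hrr₀.le z₀)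
  have hslice : ∀ᵐ s ∂(volume.restrict I), FunctionSpaces.HasWeakFDerivOn
      (⟨B, isOpen_ball⟩ : Opens (EuclideanSpace ℝ (Fin 3))) volume (w s) (G s) :=
    ae_restrict_of_ae_restrict_of_subset hIJ hGr.ae_hasWeakFDerivOn_ball
  -- measurability on the cylinder and on the thin window
  have hum : AEStronglyMeasurable (uncurry w) (volume.restrict (I ×ˢ B)) :=
    (hGr.locallyIntegrableOn.mono_set
      (by rw [coe_parabolicCylinderOpens, hQ]; exact prod_mono hIJ Subset.rfl)).aestronglyMeasurable
  have hGm : AEStronglyMeasurable (uncurry G) (volume.restrict (J ×ˢ B)) :=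
    (hGr.locallyIntegrableOn_grad.mono_set (by rw [coe_parabolicCylinderOpens, hQ])).aestronglyMeasurable
  have hprodI : (volume.restrict (I ×ˢ B) : Measure (ℝ × EuclideanSpace ℝ (Fin 3))) =
      (volume.restrict I).prod (volume.restrict B) := by
    rw [Measure.volume_eq_prod, Measure.prod_restrict]
  have hprodJ : (volume.restrict (J ×ˢ B) : Measure (ℝ × EuclideanSpace ℝ (Fin 3))) =
      (volume.restrict J).prod (volume.restrict B) := by
    rw [Measure.volume_eq_prod, Measure.prod_restrict]
  have hum3 : AEMeasurable (fun p : ℝ × EuclideanSpace ℝ (Fin 3) => ‖w p.1 p.2‖ₑ ^ (3 : ℕ))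
      ((volume.restrict I).prod (volume.restrict B)) := by
    rw [← hprodI]; exact hum.enorm.pow_const 3
  have hGm2 : AEMeasurable (fun p : ℝ × EuclideanSpace ℝ (Fin 3) =>
      ENNReal.ofReal (frobeniusNormSq (G p.1 p.2))) ((volume.restrict J).prod (volume.restrict B)) := by
    rw [← hprodJ]
    exact (continuous_frobeniusNormSq'.comp_aestronglyMeasurable hGm).aemeasurable.ennreal_ofReal
  -- slice quantities
  set c : ℝ → ℝ≥0∞ := fun s => ∫⁻ x in B, ‖w s x‖ₑ ^ (3 : ℕ) with hc
  set a : ℝ → ℝ≥0∞ := fun s => ∫⁻ x in B, ‖w s x‖ₑ ^ 2 with ha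
  set e : ℝ → ℝ≥0∞ := fun s => ∫⁻ x in B, ENNReal.ofReal (frobeniusNormSq (G s x)) with he
  -- Tonelli
  have hC3 : ∫⁻ p in I ×ˢ B, ‖w p.1 p.2‖ₑ ^ (3 : ℕ) = ∫⁻ s in I, c s := by
    rw [Measure.volume_eq_prod, setLIntegral_prod _ (by rwa [← Measure.prod_restrict])]
  have hE2 : ∫⁻ p in J ×ˢ B, ENNReal.ofReal (frobeniusNormSq (G p.1 p.2)) = ∫⁻ s in J, e s := by
    rw [Measure.volume_eq_prod, setLIntegral_prod _ (by rwa [← Measure.prod_restrict])]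
  have hem : AEMeasurable e (volume.restrict J) := hGm2.lintegral_prod_right'
  have hemI : AEMeasurable e (volume.restrict I) :=
    hem.mono_measure (Measure.restrict_mono hIJ le_rfl)
  -- the dissipation budget on the window: `∫_I e ≤ ∫∫_{Q_r} |G|² = r E(r) ≤ r^{1-ρ} M`
  have hEgauge : Rr ^ ρ * cknE r z₀ G ≤ M := by
    have h := hM r ⟨hr0, hrr₀.le⟩
    simp only [hpow] at h
    calc Rr ^ ρ * cknE r z₀ G
        ≤ Rr ^ (2 * ρ) * cknA r z₀ w + Rr ^ ρ * cknE r z₀ G + Rr ^ (2 * ρ) * cknD r z₀ q :=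
          le_add_self.trans le_self_add
      _ ≤ M := h
  have hX : ∫⁻ p in J ×ˢ B, ENNReal.ofReal (frobeniusNormSq (G p.1 p.2)) ≤ Rr ^ (1 - ρ) * M := by
    have hE : cknE r z₀ G = Rr⁻¹ * ∫⁻ p in J ×ˢ B, ENNReal.ofReal (frobeniusNormSq (G p.1 p.2)) := by
      simp only [cknE, hQ, hRr]
    have h1 : Rr ^ (1 - ρ) * (Rr ^ ρ * Rr⁻¹) = 1 := by
      rw [← ENNReal.rpow_neg_one, ← ENNReal.rpow_add _ _ hR0 hRt, ← ENNReal.rpow_add _ _ hR0 hRt,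
        show (1 - ρ) + (ρ + -1) = 0 by ring, ENNReal.rpow_zero]
    calc ∫⁻ p in J ×ˢ B, ENNReal.ofReal (frobeniusNormSq (G p.1 p.2))
        = Rr ^ (1 - ρ) * (Rr ^ ρ * Rr⁻¹) *
            ∫⁻ p in J ×ˢ B, ENNReal.ofReal (frobeniusNormSq (G p.1 p.2)) := by rw [h1, one_mul]
      _ = Rr ^ (1 - ρ) * (Rr ^ ρ * cknE r z₀ G) := by rw [hE]; ring
      _ ≤ Rr ^ (1 - ρ) * M := by gcongr
  have hIe : ∫⁻ s in I, e s ≤ Rr ^ (1 - ρ) * M :=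
    (lintegral_mono_set hIJ).trans (by rw [← hE2]; exact hX)
  have hefin : ∀ᵐ s ∂(volume.restrict I), e s < ⊤ :=
    ae_lt_top' hemI (ne_top_of_le_ne_top (ENNReal.mul_ne_top (hRne _) ENNReal.coe_ne_top) hIe)
  -- the gauged energy bound supplied by the contradiction hypothesis
  set abar : ℝ≥0∞ := Rr ^ (1 - 2 * ρ) * η₀ with habar
  have habar_top : abar ≠ ⊤ := ENNReal.mul_ne_top (hRne _) ENNReal.coe_ne_top
  have ha_le : ∀ s ∈ I, a s ≤ abar := by
    intro s hs
    have h' : Rr ^ (2 * ρ - 1) * a s ≤ η₀ := by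
      have := (hcon r ⟨hr0, hrR⟩ s (hIS hs)).le
      rwa [hpow] at this
    have hinv : (Rr ^ (2 * ρ - 1))⁻¹ = Rr ^ (1 - 2 * ρ) := by
      rw [← ENNReal.rpow_neg]; congr 1; ring
    calc a s = (Rr ^ (2 * ρ - 1))⁻¹ * (Rr ^ (2 * ρ - 1) * a s) := by
          rw [← mul_assoc, ENNReal.inv_mul_cancel (hRpos _) (hRne _), one_mul]
      _ ≤ (Rr ^ (2 * ρ - 1))⁻¹ * η₀ := by gcongr
      _ = abar := by rw [hinv]
  -- the slice estimate, a.e. on the window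
  have hpt : ∀ᵐ s ∂(volume.restrict I),
      c s ≤ abar ^ (3 / 4 : ℝ) * (Kc * (Rr ^ (-2 : ℝ) * abar + e s) ^ (3 / 4 : ℝ)) := by
    filter_upwards [hslice, hefin, ae_restrict_mem measurableSet_Ioo] with s hws hes hs
    exact slice_cubic_le hCS hr0 hws (ha_le s hs) habar_top hes.ne
  -- integrate over the window (Hölder in time)
  have hK1 : abar ^ (3 / 4 : ℝ) * Kc ≠ ⊤ :=
    ENNReal.mul_ne_top (ENNReal.rpow_ne_top_of_nonneg (by norm_num) habar_top)
      (ENNReal.rpow_ne_top_of_nonneg (by norm_num) ENNReal.coe_ne_top)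
  have hvolI : (volume.restrict I) univ = Rr ^ (2 + ρ) := by
    rw [Measure.restrict_apply_univ, hI, Real.volume_Ioo, sub_sub_cancel, hpow]
  have hDV : Rr ^ (-2 : ℝ) * abar * Rr ^ (2 + ρ) + ∫⁻ s in I, e s ≤ Rr ^ (1 - ρ) * (η₀ + M) := by
    calc Rr ^ (-2 : ℝ) * abar * Rr ^ (2 + ρ) + ∫⁻ s in I, e s
        ≤ Rr ^ (1 - ρ) * η₀ + Rr ^ (1 - ρ) * M := by
          refine add_le_add (le_of_eq ?_) hIe
          rw [habar, show Rr ^ (-2 : ℝ) * (Rr ^ (1 - 2 * ρ) * (η₀ : ℝ≥0∞)) * Rr ^ (2 + ρ) =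
              (Rr ^ (-2 : ℝ) * Rr ^ (1 - 2 * ρ) * Rr ^ (2 + ρ)) * (η₀ : ℝ≥0∞) by ring,
            ← ENNReal.rpow_add _ _ hR0 hRt, ← ENNReal.rpow_add _ _ hR0 hRt,
            show (-2 : ℝ) + (1 - 2 * ρ) + (2 + ρ) = 1 - ρ by ring]
      _ = Rr ^ (1 - ρ) * (η₀ + M) := by ring
  have hint : ∫⁻ s in I, c s ≤ abar ^ (3 / 4 : ℝ) * Kc *
      ((Rr ^ (1 - ρ) * (η₀ + M)) ^ (3 / 4 : ℝ) * (Rr ^ (2 + ρ)) ^ (1 / 4 : ℝ)) := by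
    calc ∫⁻ s in I, c s
        ≤ ∫⁻ s in I, abar ^ (3 / 4 : ℝ) * (Kc * (Rr ^ (-2 : ℝ) * abar + e s) ^ (3 / 4 : ℝ)) :=
          lintegral_mono_ae hpt
      _ = abar ^ (3 / 4 : ℝ) * Kc * ∫⁻ s in I, (Rr ^ (-2 : ℝ) * abar + e s) ^ (3 / 4 : ℝ) := by
          rw [← lintegral_const_mul' _ _ hK1]
          refine lintegral_congr fun s => ?_
          ring
      _ ≤ abar ^ (3 / 4 : ℝ) * Kc * ((∫⁻ s in I, (Rr ^ (-2 : ℝ) * abar + e s)) ^ (3 / 4 : ℝ) *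
            (volume.restrict I) univ ^ (1 / 4 : ℝ)) := by
          gcongr
          exact lintegral_rpow_three_quarters_le_mul_univ _ (aemeasurable_const.add hemI)
      _ = abar ^ (3 / 4 : ℝ) * Kc * ((Rr ^ (-2 : ℝ) * abar * Rr ^ (2 + ρ) + ∫⁻ s in I, e s) ^ (3 / 4 : ℝ) *
            (Rr ^ (2 + ρ)) ^ (1 / 4 : ℝ)) := by
          rw [lintegral_add_left' aemeasurable_const, lintegral_const, hvolI]
      _ ≤ abar ^ (3 / 4 : ℝ) * Kc *
            ((Rr ^ (1 - ρ) * (η₀ + M)) ^ (3 / 4 : ℝ) * (Rr ^ (2 + ρ)) ^ (1 / 4 : ℝ)) := by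
          gcongr
  -- assemble: the floor on this window is at most `Kc η₀^{3/4} (η₀ + M)^{3/4} < ε₀`
  have hfloor' : ENNReal.ofReal ε₀ ≤ Rr ^ (2 * ρ - 2) * ∫⁻ s in I, c s := by
    rw [← hC3, ← hpow]; exact hfloor
  have hchain : ENNReal.ofReal ε₀ ≤
      Kc * ((η₀ : ℝ≥0∞) ^ (3 / 4 : ℝ) * ((η₀ : ℝ≥0∞) + M) ^ (3 / 4 : ℝ)) := by
    calc ENNReal.ofReal ε₀ ≤ Rr ^ (2 * ρ - 2) * ∫⁻ s in I, c s := hfloor'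
      _ ≤ Rr ^ (2 * ρ - 2) * (abar ^ (3 / 4 : ℝ) * Kc *
          ((Rr ^ (1 - ρ) * (η₀ + M)) ^ (3 / 4 : ℝ) * (Rr ^ (2 + ρ)) ^ (1 / 4 : ℝ))) := by gcongr
      _ = Kc * ((η₀ : ℝ≥0∞) ^ (3 / 4 : ℝ) * ((η₀ : ℝ≥0∞) + M) ^ (3 / 4 : ℝ)) := by
          rw [habar]; exact rpow_bookkeeping hR0 hRt ρ η₀ M Kc
  have hηM : (η₀ : ℝ≥0∞) * (η₀ + M) ≤ η₀ * (M + 1) := by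
    rw [add_comm (M : ℝ≥0∞) 1]
    gcongr
    exact_mod_cast hη₁
  have hfin : Kc * ((η₀ : ℝ≥0∞) ^ (3 / 4 : ℝ) * ((η₀ : ℝ≥0∞) + M) ^ (3 / 4 : ℝ)) ≤
      Kc * (((η₀ : ℝ≥0∞) * ((M : ℝ≥0∞) + 1)) ^ (3 / 4 : ℝ)) := by
    rw [← ENNReal.mul_rpow_of_nonneg _ _ (by norm_num : (0 : ℝ) ≤ 3 / 4)]
    gcongr Kc * ?_
    exact ENNReal.rpow_le_rpow hηM (by norm_num)
  exact lt_irrefl _ ((hchain.trans hfin).trans_lt hsmall')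

end Summit.NavierStokesRegularity.NavierStokesRegularity.Theorems.ConservativeEngine.Floor
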